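import Summits.Ventures.HodgeRepro2.T5SU11Iwasawa

/-!
# Uniqueness of the Iwasawa coordinates of `SU(1,1)`

`T5SU11Iwasawa` writes every `g ∈ SU(1,1)` as `n_s a_t rot u`. Here the coordinates are shown to be
determined by `g`: the orbit `(n_s a_t) · 0 = (τ - i u) / (1 - i u)` with `τ = tanh t`, `u = s (1 - τ)`
(`orbit_unip_mul_hyp`) determines `τ` and `u` — `τ = x - y²/(1-x)` and `u = -y/(1-x)` for the orbit
`x + i y` (`tanh_eq_of_orbit_eq`, `mul_eq_of_orbit_eq`) — hence `t` (`tanh` is injective: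
`tanh_injective`), then `s`, and finally the rotation `rot u` by cancellation (`rot_injective`).
Together with `exists_unip_mul_hyp_mul_rot` this makes `(s, t, u) ↦ n_s a_t rot u` a BIJECTION
`ℝ × ℝ × Circle → SU(1,1)` (`unipHypRot_bijective`), and likewise for `K A N`
(`rotHypUnip_bijective`). Nothing is claimed about (N).

Blind lane: Mathlib + the HodgeRepro2 prefix only; no sorry; axioms ⊆ {propext, Classical.choice,
Quot.sound}.
-/

namespace Summit.Ventures.HodgeRepro2.T5SU11IwasawaUnique

open Metric Filter Topology Set Complex
open T5UnitaryBound T5PoincareDensity T5PoincareInvariance T5SU11Unimodular T5SU11Fibration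
  T5SU11Cartan T5SU11OneParameter T5BergmanCoefficient T5SU11UnipotentSubgroup T5SU11Iwasawa

/-! ### Injectivity of `tanh` and of `rot` -/

/-- `tanh` is injective: `sinh (t - t') = cosh t cosh t' (tanh t - tanh t')`. -/
theorem tanh_injective : Function.Injective Real.tanh := by
  intro t t' h
  have hc : 0 < Real.cosh t := Real.cosh_pos t
  have hc' : 0 < Real.cosh t' := Real.cosh_pos t'
  have e : Real.sinh (t - t') = Real.cosh t * Real.cosh t' * (Real.tanh t - Real.tanh t') := by
    rw [Real.sinh_sub, Real.tanh_eq_sinh_div_cosh, Real.tanh_eq_sinh_div_cosh]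
    field_simp
  rw [h, sub_self, mul_zero] at e
  have := Real.sinh_injective (e.trans Real.sinh_zero.symm)
  linarith

/-- `a(rot u) = u`. -/
lemma mat_rot_zero_zero (u : Circle) : mat (rot u) 0 0 = (u : ℂ) := by
  rw [show mat (rot u) = su11 (u : ℂ) 0 from coe_rot u]
  rfl

/-- `rot` is injective. -/
theorem rot_injective : Function.Injective rot := by
  intro u u' h
  have := mat_rot_zero_zero u
  rw [h, mat_rot_zero_zero] at this
  exact Circle.ext this.symm

/-! ### The orbit of `0` under `n_s a_t` determines `(s, t)` -/

/-- `(n_s a_t) · 0 = ((1 + i s) τ - i s) / (i s τ + (1 - i s))` with `τ = tanh t`. -/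
lemma orbit_unip_mul_hyp (s t : ℝ) :
    orbit (unip s * hyp t) =
      ((1 + (s : ℂ) * I) * (Real.tanh t : ℂ) - (s : ℂ) * I) /
        ((s : ℂ) * I * (Real.tanh t : ℂ) + (1 - (s : ℂ) * I)) := by
  rw [orbit_mul, orbit_hyp]
  exact mobius_unip_apply s (Real.tanh t : ℂ)

/-- The denominator `i s τ + (1 - i s)` has real part `1`, hence is non-zero. -/
lemma denom_ne_zero (s τ : ℝ) : (s : ℂ) * I * (τ : ℂ) + (1 - (s : ℂ) * I) ≠ 0 := by
  intro h0
  have := congrArg Complex.re h0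
  simp at this

/-- The real part of the orbit: `x` with `τ = x + y u`, `u = s (1 - τ)`. -/
lemma orbit_unip_mul_hyp_re_im (s t : ℝ) :
    Real.tanh t = (orbit (unip s * hyp t)).re +
        (orbit (unip s * hyp t)).im * (s * (1 - Real.tanh t)) ∧
      (orbit (unip s * hyp t)).im =
        -(s * (1 - Real.tanh t)) + (orbit (unip s * hyp t)).re * (s * (1 - Real.tanh t)) := by
  obtain ⟨τ, hτ⟩ : ∃ τ : ℝ, τ = Real.tanh t := ⟨_, rfl⟩
  have hw : orbit (unip s * hyp t) =
      ((1 + (s : ℂ) * I) * (τ : ℂ) - (s : ℂ) * I) / ((s : ℂ) * I * (τ : ℂ) + (1 - (s : ℂ) * I)) := by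
    rw [orbit_unip_mul_hyp, hτ]
  rw [← hτ]
  have hden := denom_ne_zero s τ
  have e : orbit (unip s * hyp t) * ((s : ℂ) * I * (τ : ℂ) + (1 - (s : ℂ) * I)) =
      (1 + (s : ℂ) * I) * (τ : ℂ) - (s : ℂ) * I := by
    rw [hw, div_mul_cancel₀ _ hden]
  have e' := Complex.ext_iff.1 e
  simp at e'
  obtain ⟨e1, e2⟩ := e'
  constructor
  · linear_combination -e1
  · linear_combination e2

/-- `tanh t` is determined by the orbit: `tanh t = x - y²/(1-x)` for `(n_s a_t) · 0 = x + i y`. -/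
theorem tanh_eq_of_orbit (s t : ℝ) :
    Real.tanh t = (orbit (unip s * hyp t)).re -
      (orbit (unip s * hyp t)).im ^ 2 / (1 - (orbit (unip s * hyp t)).re) := by
  obtain ⟨e1, e2⟩ := orbit_unip_mul_hyp_re_im s t
  have hx1 : (orbit (unip s * hyp t)).re < 1 := by
    have h := orbit_mem_ball (unip s * hyp t)
    have h1 := mem_ball_zero_iff.mp h
    have h2 := Complex.abs_re_le_norm (orbit (unip s * hyp t))
    have := (abs_le.1 h2).2
    linarith
  have h1x : (1 - (orbit (unip s * hyp t)).re) ≠ 0 := by linarith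
  set x := (orbit (unip s * hyp t)).re
  set y := (orbit (unip s * hyp t)).im
  set u := s * (1 - Real.tanh t)
  -- from `e2`: `u (1 - x) = -y`
  have hu : u * (1 - x) = -y := by linear_combination e2
  have key : y ^ 2 / (1 - x) = x - Real.tanh t := by
    rw [div_eq_iff h1x]
    linear_combination (1 - x) * e1 + y * hu
  rw [key]
  ring

/-- `s (1 - tanh t)` is determined by the orbit: `s (1 - tanh t) = -y/(1-x)`. -/
theorem mul_eq_of_orbit (s t : ℝ) :
    s * (1 - Real.tanh t) =
      -(orbit (unip s * hyp t)).im / (1 - (orbit (unip s * hyp t)).re) := by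
  obtain ⟨_, e2⟩ := orbit_unip_mul_hyp_re_im s t
  have hx1 : (orbit (unip s * hyp t)).re < 1 := by
    have h := orbit_mem_ball (unip s * hyp t)
    have h1 := mem_ball_zero_iff.mp h
    have h2 := Complex.abs_re_le_norm (orbit (unip s * hyp t))
    have := (abs_le.1 h2).2
    linarith
  have h1x : (1 - (orbit (unip s * hyp t)).re) ≠ 0 := by linarith
  rw [eq_div_iff h1x]
  linear_combination e2

/-! ### Uniqueness -/

/-- **The `N A` coordinates are unique**: `n_s a_t = n_{s'} a_{t'}` implies `s = s'` and `t = t'`. -/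
theorem unip_mul_hyp_injective {s t s' t' : ℝ} (h : unip s * hyp t = unip s' * hyp t') :
    s = s' ∧ t = t' := by
  have htanh : Real.tanh t = Real.tanh t' := by
    rw [tanh_eq_of_orbit s t, h, ← tanh_eq_of_orbit s' t']
  have ht : t = t' := tanh_injective htanh
  have hu : s * (1 - Real.tanh t) = s' * (1 - Real.tanh t') := by
    rw [mul_eq_of_orbit s t, h, ← mul_eq_of_orbit s' t']
  rw [← ht] at hu
  have h1τ : (1 - Real.tanh t) ≠ 0 := by
    have := Real.tanh_lt_one t
    linarith
  exact ⟨mul_right_cancel₀ h1τ hu, ht⟩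

/-- **Uniqueness of the Iwasawa coordinates `N A K`**: `n_s a_t rot u = n_{s'} a_{t'} rot u'` implies
`s = s'`, `t = t'` and `u = u'`. -/
theorem iwasawa_unique {s t s' t' : ℝ} {u u' : Circle}
    (h : unip s * hyp t * rot u = unip s' * hyp t' * rot u') : s = s' ∧ t = t' ∧ u = u' := by
  have horb : orbit (unip s * hyp t) = orbit (unip s' * hyp t') := by
    have e1 : orbit (unip s * hyp t) = orbit (unip s * hyp t * rot u) := by
      rw [orbit_mul (unip s * hyp t) (rot u), orbit_rot]
      rfl
    have e2 : orbit (unip s' * hyp t') = orbit (unip s' * hyp t' * rot u') := by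
      rw [orbit_mul (unip s' * hyp t') (rot u'), orbit_rot]
      rfl
    rw [e1, e2, h]
  have htanh : Real.tanh t = Real.tanh t' := by
    rw [tanh_eq_of_orbit s t, horb, ← tanh_eq_of_orbit s' t']
  have ht : t = t' := tanh_injective htanh
  have hu : s * (1 - Real.tanh t) = s' * (1 - Real.tanh t') := by
    rw [mul_eq_of_orbit s t, horb, ← mul_eq_of_orbit s' t']
  rw [← ht] at hu
  have h1τ : (1 - Real.tanh t) ≠ 0 := by
    have := Real.tanh_lt_one t
    linarith
  have hs : s = s' := mul_right_cancel₀ h1τ hu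
  subst hs ht
  have hrot : rot u = rot u' := mul_left_cancel h
  exact ⟨rfl, rfl, rot_injective hrot⟩

/-- **`(s, t, u) ↦ n_s a_t rot u` is a bijection `ℝ × ℝ × Circle → SU(1,1)`** (Iwasawa `N A K`). -/
theorem unipHypRot_bijective :
    Function.Bijective fun p : ℝ × ℝ × Circle => unip p.1 * hyp p.2.1 * rot p.2.2 := by
  constructor
  · rintro ⟨s, t, u⟩ ⟨s', t', u'⟩ h
    obtain ⟨hs, ht, hu⟩ := iwasawa_unique h
    simp only [Prod.mk.injEq]
    exact ⟨hs, ht, hu⟩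
  · intro g
    obtain ⟨s, t, u, h⟩ := exists_unip_mul_hyp_mul_rot g
    exact ⟨(s, t, u), h.symm⟩

/-- **`(u, t, s) ↦ rot u a_t n_s` is a bijection `Circle × ℝ × ℝ → SU(1,1)`** (Iwasawa `K A N`). -/
theorem rotHypUnip_bijective :
    Function.Bijective fun p : Circle × ℝ × ℝ => rot p.1 * hyp p.2.1 * unip p.2.2 := by
  constructor
  · rintro ⟨u, t, s⟩ ⟨u', t', s'⟩ h
    have h' : unip (-s) * hyp (-t) * rot u⁻¹ = unip (-s') * hyp (-t') * rot u'⁻¹ := by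
      have := congrArg (fun g : SU11 => g⁻¹) h
      simp only at this
      rw [mul_inv_rev, mul_inv_rev, mul_inv_rev, mul_inv_rev, ← unip_neg, ← hyp_neg, ← map_inv,
        ← unip_neg, ← hyp_neg, ← map_inv] at this
      simpa only [mul_assoc] using this
    obtain ⟨hs, ht, hu⟩ := iwasawa_unique h'
    simp only [Prod.mk.injEq]
    exact ⟨inv_injective hu, neg_injective ht, neg_injective hs⟩
  · intro g
    obtain ⟨u, t, s, h⟩ := exists_rot_mul_hyp_mul_unip g
    exact ⟨(u, t, s), h.symm⟩

end Summit.Ventures.HodgeRepro2.T5SU11IwasawaUnique
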